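import Summits.CriticalPhenomena.SAWScalingLimit.Theorems.BoundaryTP2.Negative.TP2CertKit
import Summits.CriticalPhenomena.SAWScalingLimit.Theorems.SAWTotalPositivityBoundaryTP2Symmetry
import Summits.CriticalPhenomena.SAWScalingLimit.Theorems.SAWTotalPositivityBoundaryTP2Kernel
import HarnessLib

/-!
# Crux `BoundaryTP2` (stmt-CriticalPhenomena-7115): the FULL typed instance on a box — all quadruples

Certified-compute seat (refuter `ccert`), part 3 of the certificate kit.  Parts 1–2 certify the circular TP₂
inequalities for boundary quadruples in cyclic order.  Here the crux is certified AS TYPED on a whole box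
`Ω = rectDomain a b`, `δ = 1`: for EVERY quadruple `(p₁,p₂,p₃,p₄)` of lattice points satisfying the crux's
hypotheses (i) interlacing, (ii), (iii) disjoint realisability — interior points, plaquettes and corner traps
included — `Z(p₁,p₃)Z(p₂,p₄) ≤ Z(p₁,p₂)Z(p₃,p₄)` at every `x ∈ [10/27, 5/13]`, hence at `x_c`.

The kernel computation `fullCheckAt a b K F ctab i₁` runs over the ordered quadruples of box sites with first
index `i₁` minimal (the Klein four-group of relabellings, landed in `…BoundaryTP2Symmetry`, reduces every
quadruple to such one) and for each either passes the exact subdivision certificate of part 1, or FINDS a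
disjoint realisation of the crossing pairing — a SAW `p₁ → p₃` avoiding `p₂, p₄` and a SAW `p₂ → p₄` avoiding
it, from the proved-sound enumerator — which refutes hypothesis (i) (`not_interlaced_of_disjointWitness`).
Hypotheses (ii), (iii) are used only for pairwise distinctness and membership in the box.  Everything proved;
instances (`TP2CertFull3x3`, …) supply the all-pairs table and the `decide`s. [folklore]
-/

namespace Summit.CriticalPhenomena.SAWScalingLimit.Theorems.BoundaryTP2.Negative.Cert

open Literature.Probability.LatticeModels Literature.Probability.RandomPlanarGeometry
open Summit.CriticalPhenomena.SAWScalingLimit.Theorems.EdgeOfPositivity.Negative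
open Summit.CriticalPhenomena.SAWScalingLimit.Theorems.BoundaryTP2
open scoped ENNReal

/-! ## §1 The box graph and its path kernel -/

/-- The domain graph of the box: `ℤ²` induced on `{0..a} × {0..b}`. [folklore] -/
abbrev boxGraph (a b : ℕ) : SimpleGraph (Site 2) := discreteDomainGraph (rectDomain a b) 1

/-- `Zx` is the fugacity-`x` path kernel of the domain graph. [folklore] -/
theorem Zx_eq_pathKernel (x : ℝ) (Ω : Set ℂ) (δ : ℝ) (u v : Site 2) :
    Zx x Ω δ u v = pathKernel (discreteDomainGraph Ω δ) x u v :=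
  Equiv.tsum_eq (domainSAWEquivPath Ω δ u v)
    (fun γ : (discreteDomainGraph Ω δ).Path u v => ENNReal.ofReal (x ^ γ.1.length))

/-- Exact path kernel of the box from the coefficient vector. [folklore] -/
theorem pathKernel_box_eq_evPoly {a b : ℕ} {u v : Site 2} (hu : u ∈ rectSites a b) {x : ℝ} (hx : 0 ≤ x) :
    pathKernel (boxGraph a b) x u v = ENNReal.ofReal (evPoly (pathCount a b u v) x) := by
  rw [← Zx_eq_pathKernel]; exact Zx_eq_evPoly hu hx

/-! ## §2 Searching disjoint realisations of the crossing pairing -/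

/-- Neighbour lists of the box avoiding a list of forbidden sites. [folklore] -/
def nbrAvoid (a b : ℕ) (bad : List (Site 2)) (v : Site 2) : List (Site 2) :=
  (nbrBox a b v).filter fun w => w ∉ bad

/-- Enough fuel for every simple path of the box. [folklore] -/
def fuelOf (a b : ℕ) : ℕ := (a + 1) * (b + 1) - 1

/-- Vertices visited while following neighbour lists are listed neighbours of something. [folklore] -/
theorem Follows.forall_mem {α : Type*} {nbr : α → List α} :
    ∀ {cur : α} {rest : List α}, Follows nbr cur rest → ∀ w ∈ rest, ∃ c, w ∈ nbr c
  | _, [], _ => by simp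
  | cur, w :: rest, h => by
    intro u hu
    rcases List.mem_cons.1 hu with rfl | hu
    · exact ⟨cur, h.1⟩
    · exact Follows.forall_mem h.2 u hu

/-- **Soundness of the avoiding enumerator**: every listed sequence is the support of a self-avoiding walk of
the box from `u`, all of whose other vertices avoid `bad`. [folklore] -/
theorem exists_walk_of_mem_allPaths_nbrAvoid {a b : ℕ} {bad : List (Site 2)} {u v : Site 2} {L : List (Site 2)}
    (hu : u ∈ rectSites a b) (hL : L ∈ allPaths (nbrAvoid a b bad) v (fuelOf a b) u []) :
    ∃ p : (boxGraph a b).Walk u v, p.IsPath ∧ p.support = L ∧ ∀ w ∈ L, w = u ∨ w ∉ bad := by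
  obtain ⟨rest, rfl, hf, hnd, -, hlast⟩ := allPaths_sound (nbrAvoid a b bad) v _ u [] L hL
  have hadj : ∀ x y : Site 2, x ∈ rectSites a b → y ∈ nbrAvoid a b bad x → (boxGraph a b).Adj x y :=
    fun x y hx hy => adj_of_mem_nbrBox x y hx (List.mem_filter.1 hy).1
  have hS : ∀ x y : Site 2, x ∈ rectSites a b → y ∈ nbrAvoid a b bad x → y ∈ rectSites a b :=
    fun x y hx hy => mem_rectSites_of_mem_nbrBox x y hx (List.mem_filter.1 hy).1
  subst hlast
  refine ⟨walkOf (nbrAvoid a b bad) (rectSites a b) hadj hS u rest hu hf, ?_, support_walkOf _ _ _ _ _ _ _ _, ?_⟩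
  · exact SimpleGraph.Walk.IsPath.mk' (by rw [support_walkOf]; exact hnd)
  · intro w hw
    rcases List.mem_cons.1 hw with rfl | hw
    · exact Or.inl rfl
    · obtain ⟨c, hc⟩ := Follows.forall_mem hf w hw
      have := (List.mem_filter.1 hc).2
      simp only [decide_eq_true_eq] at this
      exact Or.inr this

/-- **Witness search**: a SAW `P : p₁ → p₃` avoiding `p₂, p₄` such that some SAW `p₂ → p₄` avoids `P`
(the crossing pairing is disjointly realisable; kernel-lazy). [folklore] -/
def disjointWitness (a b : ℕ) (p₁ p₂ p₃ p₄ : Site 2) : Bool :=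
  ((allPaths (nbrAvoid a b [p₂, p₄]) p₃ (fuelOf a b) p₁ []).find? fun P =>
      !(allPaths (nbrAvoid a b P) p₄ (fuelOf a b) p₂ []).isEmpty).isSome

/-- **A found witness refutes interlacing.** [folklore] -/
theorem not_interlaced_of_disjointWitness {a b : ℕ} {p₁ p₂ p₃ p₄ : Site 2}
    (h : disjointWitness a b p₁ p₂ p₃ p₄ = true) (h₁ : p₁ ∈ rectSites a b) (h₂ : p₂ ∈ rectSites a b)
    (h12 : p₁ ≠ p₂) : ¬ Interlaced (boxGraph a b) p₁ p₂ p₃ p₄ := by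
  intro hI
  rw [disjointWitness, Option.isSome_iff_exists] at h
  obtain ⟨P, hP⟩ := h
  have hPmem := List.mem_of_find?_eq_some hP
  have hPQ := List.find?_some hP
  obtain ⟨Q, hQ⟩ : ∃ Q, Q ∈ allPaths (nbrAvoid a b P) p₄ (fuelOf a b) p₂ [] := by
    cases hl : allPaths (nbrAvoid a b P) p₄ (fuelOf a b) p₂ [] with
    | nil => rw [hl] at hPQ; simp at hPQ
    | cons Q l => exact ⟨Q, List.mem_cons_self⟩
  obtain ⟨p, hp, hpsupp, hpav⟩ := exists_walk_of_mem_allPaths_nbrAvoid h₁ hPmem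
  obtain ⟨q, hq, hqsupp, hqav⟩ := exists_walk_of_mem_allPaths_nbrAvoid h₂ hQ
  obtain ⟨v, hvp, hvq⟩ := hI ⟨p, hp⟩ ⟨q, hq⟩
  have hvP : v ∈ P := by rw [← hpsupp]; exact hvp
  have hvQ : v ∈ Q := by rw [← hqsupp]; exact hvq
  rcases hqav v hvQ with rfl | hv
  · -- `v = p₂` lies on `P`, but `P` avoids `p₂` (and `p₁ ≠ p₂`)
    rcases hpav _ hvP with h | h
    · exact h12 h.symm
    · exact h (by simp)
  · exact hv hvP

/-! ## §3 The full checker -/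

/-- Symmetrised table lookup. [folklore] -/
def cfs (ctab : List (List (List ℕ))) (i j : ℕ) : List ℕ := if i < j then cf ctab i j else cf ctab j i

/-- Cheap pre-test: the inequality is already violated at `x = 10/27` (then only a witness can help). [folklore] -/
def violatedLo (K : ℕ) (A B C D : List ℕ) : Bool :=
  Nat.blt (hornerH K A 130 351 * hornerH K B 130 351) (hornerH K C 130 351 * hornerH K D 130 351)

/-- One ordered quadruple of box-site indices: certificate, else witness. [folklore] -/
def quadFull (a b K F : ℕ) (ctab : List (List (List ℕ))) (i₁ i₂ i₃ i₄ : ℕ) : Bool :=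
  (!violatedLo K (cfs ctab i₁ i₂) (cfs ctab i₃ i₄) (cfs ctab i₁ i₃) (cfs ctab i₂ i₄) &&
      certRec K (cfs ctab i₁ i₂) (cfs ctab i₃ i₄) (cfs ctab i₁ i₃) (cfs ctab i₂ i₄) F 0 0) ||
    disjointWitness a b ((boxList a b).getD i₁ 0) ((boxList a b).getD i₂ 0) ((boxList a b).getD i₃ 0)
      ((boxList a b).getD i₄ 0)

/-- **The full checker at first index `i₁`**: table lengths, and every ordered quadruple of pairwise distinct
indices with `i₁` minimal. [folklore] -/
def fullCheckAt (a b K F : ℕ) (ctab : List (List (List ℕ))) (i₁ : ℕ) : Bool :=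
  lenOK K ctab &&
    (List.range (boxList a b).length).all fun i₂ => (List.range (boxList a b).length).all fun i₃ =>
      (List.range (boxList a b).length).all fun i₄ =>
        !(decide (i₁ < i₂) && decide (i₁ < i₃) && decide (i₁ < i₄) && !(i₂ == i₃) && !(i₂ == i₄) && !(i₃ == i₄)) ||
          quadFull a b K F ctab i₁ i₂ i₃ i₄

/-! ## §4 Soundness -/

section Sound

variable {a b K F : ℕ} {ctab : List (List (List ℕ))}

/-- The symmetrised lookup is the path kernel, for distinct in-range indices. [folklore] -/
theorem pathKernel_eq_cfs
    (hct : (rowsOf (boxList a b)).map (List.map fun p : Site 2 × Site 2 => pathCount a b p.1 p.2) = ctab)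
    {i j : ℕ} (hij : i ≠ j) (hi : i < (boxList a b).length) (hj : j < (boxList a b).length) {x : ℝ} (hx : 0 ≤ x) :
    pathKernel (boxGraph a b) x ((boxList a b).getD i 0) ((boxList a b).getD j 0) =
      ENNReal.ofReal (evPoly (cfs ctab i j) x) := by
  have hmem : ∀ n, n < (boxList a b).length → (boxList a b).getD n 0 ∈ rectSites a b := fun n hn => by
    rw [List.getD_eq_getElem _ _ hn]; exact mem_boxList_iff.1 (List.getElem_mem hn)
  unfold cfs
  split_ifs with hlt
  · rw [pathKernel_box_eq_evPoly (hmem i hi) hx, cf_eq_pathCount hct hlt hj]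
  · have hji : j < i := lt_of_le_of_ne (not_lt.1 hlt) (Ne.symm hij)
    rw [pathKernel_comm, pathKernel_box_eq_evPoly (hmem j hj) hx, cf_eq_pathCount hct hji hi]

/-- **Soundness in canonical position** (`i₁` minimal). [folklore] -/
theorem tp2_canonical_of_fullCheckAt
    (hct : (rowsOf (boxList a b)).map (List.map fun p : Site 2 × Site 2 => pathCount a b p.1 p.2) = ctab)
    {i₁ : ℕ} (h : fullCheckAt a b K F ctab i₁ = true) {i₂ i₃ i₄ : ℕ} (h12 : i₁ < i₂) (h13 : i₁ < i₃)
    (h14 : i₁ < i₄) (h23 : i₂ ≠ i₃) (h24 : i₂ ≠ i₄) (h34 : i₃ ≠ i₄) (hi₂ : i₂ < (boxList a b).length)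
    (hi₃ : i₃ < (boxList a b).length) (hi₄ : i₄ < (boxList a b).length) {x : ℝ} (hlo : 10 / 27 ≤ x)
    (hhi : x ≤ 5 / 13)
    (hI : Interlaced (boxGraph a b) ((boxList a b).getD i₁ 0) ((boxList a b).getD i₂ 0)
      ((boxList a b).getD i₃ 0) ((boxList a b).getD i₄ 0)) :
    pathKernel (boxGraph a b) x ((boxList a b).getD i₁ 0) ((boxList a b).getD i₃ 0) *
        pathKernel (boxGraph a b) x ((boxList a b).getD i₂ 0) ((boxList a b).getD i₄ 0) ≤
      pathKernel (boxGraph a b) x ((boxList a b).getD i₁ 0) ((boxList a b).getD i₂ 0) *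
        pathKernel (boxGraph a b) x ((boxList a b).getD i₃ 0) ((boxList a b).getD i₄ 0) := by
  have hi₁ : i₁ < (boxList a b).length := h12.trans hi₂
  have hx : 0 ≤ x := le_trans (by norm_num) hlo
  simp only [fullCheckAt, Bool.and_eq_true, List.all_eq_true, List.mem_range] at h
  obtain ⟨hlen, hall⟩ := h
  have hq := hall i₂ hi₂ i₃ hi₃ i₄ hi₄
  have hguard : (decide (i₁ < i₂) && decide (i₁ < i₃) && decide (i₁ < i₄) && !(i₂ == i₃) && !(i₂ == i₄) &&
      !(i₃ == i₄)) = true := by simp [h12, h13, h14, h23, h24, h34]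
  rw [hguard] at hq
  simp only [Bool.not_true, Bool.false_or, quadFull, Bool.or_eq_true, Bool.and_eq_true] at hq
  rcases hq with ⟨-, hcert⟩ | hwit
  · have hL := fun i j => show (cfs ctab i j).length ≤ K + 1 by
      unfold cfs; split_ifs <;> exact length_cf_le hlen _ _
    have h1 : tR 0 0 ≤ x := by rw [tR_zero_zero]; exact hlo
    have h2 : x ≤ tR 0 (0 + 1) := by rw [zero_add, tR_zero_one]; exact hhi
    have key := certRec_sound (hL i₁ i₂) (hL i₃ i₄) (hL i₁ i₃) (hL i₂ i₄) F 0 0 hcert h1 h2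
    rw [pathKernel_eq_cfs hct (ne_of_lt h13) hi₁ hi₃ hx, pathKernel_eq_cfs hct h24 hi₂ hi₄ hx,
      pathKernel_eq_cfs hct (ne_of_lt h12) hi₁ hi₂ hx, pathKernel_eq_cfs hct h34 hi₃ hi₄ hx,
      ← ENNReal.ofReal_mul (evPoly_nonneg _ hx), ← ENNReal.ofReal_mul (evPoly_nonneg _ hx)]
    exact ENNReal.ofReal_le_ofReal key
  · have hmem : ∀ n, n < (boxList a b).length → (boxList a b).getD n 0 ∈ rectSites a b := fun n hn => by
      rw [List.getD_eq_getElem _ _ hn]; exact mem_boxList_iff.1 (List.getElem_mem hn)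
    have hne : (boxList a b).getD i₁ 0 ≠ (boxList a b).getD i₂ 0 := by
      rw [List.getD_eq_getElem _ _ hi₁, List.getD_eq_getElem _ _ hi₂, Ne,
        (boxList_nodup a b).getElem_inj_iff]
      exact ne_of_lt h12
    exact absurd hI (not_interlaced_of_disjointWitness hwit (hmem i₁ hi₁) (hmem i₂ hi₂) hne)

/-- A path with distinct ends starts in the box, and then stays in it. [folklore] -/
theorem mem_rectSites_of_path {a b : ℕ} {u v : Site 2} (P : (boxGraph a b).Path u v) (huv : u ≠ v) :
    u ∈ rectSites a b ∧ v ∈ rectSites a b := by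
  obtain ⟨w, hw⟩ := exists_adj_of_walk_ne P.1 huv
  have hu : u ∈ rectSites a b := (adj_rect_iff.1 hw).2.1
  exact ⟨hu, support_subset_rectSites hu P.1 v P.1.end_mem_support⟩

/-- **The crux on the whole box, graph form**: every interlaced, disjointly realisable quadruple of the box
graph satisfies TP₂ at every `x ∈ [10/27, 5/13]`. [folklore] -/
theorem graphTP2_box_of_fullCheck
    (hct : (rowsOf (boxList a b)).map (List.map fun p : Site 2 × Site 2 => pathCount a b p.1 p.2) = ctab)
    (hall : ∀ i < (boxList a b).length, fullCheckAt a b K F ctab i = true) {x : ℝ} (hlo : 10 / 27 ≤ x)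
    (hhi : x ≤ 5 / 13) (p₁ p₂ p₃ p₄ : Site 2) (hI : Interlaced (boxGraph a b) p₁ p₂ p₃ p₄)
    (hD₁ : DisjointPaths (boxGraph a b) p₁ p₂ p₃ p₄) (hD₂ : DisjointPaths (boxGraph a b) p₁ p₄ p₂ p₃) :
    pathKernel (boxGraph a b) x p₁ p₃ * pathKernel (boxGraph a b) x p₂ p₄ ≤
      pathKernel (boxGraph a b) x p₁ p₂ * pathKernel (boxGraph a b) x p₃ p₄ := by
  obtain ⟨n12, n13, n14, n23, n24, n34⟩ := pairwise_ne_of_disjointPaths hD₁ hD₂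
  -- the four points are box sites
  obtain ⟨P, Q, -⟩ := hD₁
  obtain ⟨m₁, m₂⟩ := mem_rectSites_of_path P n12
  obtain ⟨m₃, m₄⟩ := mem_rectSites_of_path Q n34
  -- indices
  have idx : ∀ {p : Site 2}, p ∈ rectSites a b → ∃ i, i < (boxList a b).length ∧ (boxList a b).getD i 0 = p := by
    intro p hp
    obtain ⟨i, hi, hip⟩ := List.mem_iff_getElem.1 (mem_boxList_iff.2 hp)
    exact ⟨i, hi, by rw [List.getD_eq_getElem _ _ hi, hip]⟩
  obtain ⟨i₁, hi₁, rfl⟩ := idx m₁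
  obtain ⟨i₂, hi₂, rfl⟩ := idx m₂
  obtain ⟨i₃, hi₃, rfl⟩ := idx m₃
  obtain ⟨i₄, hi₄, rfl⟩ := idx m₄
  have d12 : i₁ ≠ i₂ := fun h => n12 (by rw [h])
  have d13 : i₁ ≠ i₃ := fun h => n13 (by rw [h])
  have d14 : i₁ ≠ i₄ := fun h => n14 (by rw [h])
  have d23 : i₂ ≠ i₃ := fun h => n23 (by rw [h])
  have d24 : i₂ ≠ i₄ := fun h => n24 (by rw [h])
  have d34 : i₃ ≠ i₄ := fun h => n34 (by rw [h])
  -- which index is minimal?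
  rcases lt_or_gt_of_ne d12 with h12 | h12 <;> rcases lt_or_gt_of_ne d13 with h13 | h13 <;>
    rcases lt_or_gt_of_ne d14 with h14 | h14 <;> rcases lt_or_gt_of_ne d23 with h23 | h23 <;>
    rcases lt_or_gt_of_ne d24 with h24 | h24 <;> rcases lt_or_gt_of_ne d34 with h34 | h34
  all_goals first
    -- `i₁` minimal
    | exact tp2_canonical_of_fullCheckAt hct (hall i₁ hi₁) h12 h13 h14 d23 d24 d34 hi₂ hi₃ hi₄ hlo hhi hI
    -- `i₂` minimal: relabel `(12)(34)`
    | exact tp2_of_swap _ x (tp2_canonical_of_fullCheckAt hct (hall i₂ hi₂) h12 h24 h23 d14 d13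
        d34.symm hi₁ hi₄ hi₃ hlo hhi hI.swap)
    -- `i₃` minimal: relabel `(13)(24)`
    | exact tp2_of_rotate _ x (tp2_canonical_of_fullCheckAt hct (hall i₃ hi₃) h34 h13 h23 d14.symm d24.symm
        d12 hi₄ hi₁ hi₂ hlo hhi hI.rotate)
    -- `i₄` minimal: relabel `(14)(23)`
    | exact tp2_of_reflect _ x (tp2_canonical_of_fullCheckAt hct (hall i₄ hi₄) h34 h24 h14 d23.symm d13.symm
        d12.symm hi₃ hi₂ hi₁ hlo hhi hI.reflect)
    | omega

/-- **The crux `BoundaryTP2` holds on the box `Ω = rectDomain a b`, `δ = 1`, as typed** (all quadruples;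
`Z = SAW.weight … univ` at `x_c`), under the quoted bounds `2.6 ≤ μ ≤ 2.7`, given the all-pairs table and the
kernel checks. [folklore] -/
theorem boundaryTP2_box_of_fullCheck (hμ : SAW.LawlerSchrammWerner2004SAW_connectiveConstant_bounds)
    (hct : (rowsOf (boxList a b)).map (List.map fun p : Site 2 × Site 2 => pathCount a b p.1 p.2) = ctab)
    (hall : ∀ i < (boxList a b).length, fullCheckAt a b K F ctab i = true) (p₁ p₂ p₃ p₄ : Site 2)
    (hI : ∀ (P : SAW.DomainSAW (rectDomain a b) 1 p₁ p₃) (Q : SAW.DomainSAW (rectDomain a b) 1 p₂ p₄),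
      ∃ v, v ∈ P.walk.support ∧ v ∈ Q.walk.support)
    (hD₁ : ∃ (P : SAW.DomainSAW (rectDomain a b) 1 p₁ p₂) (Q : SAW.DomainSAW (rectDomain a b) 1 p₃ p₄),
      List.Disjoint P.walk.support Q.walk.support)
    (hD₂ : ∃ (P : SAW.DomainSAW (rectDomain a b) 1 p₁ p₄) (Q : SAW.DomainSAW (rectDomain a b) 1 p₂ p₃),
      List.Disjoint P.walk.support Q.walk.support) :
    SAW.weight (rectDomain a b) 1 p₁ p₃ Set.univ * SAW.weight (rectDomain a b) 1 p₂ p₄ Set.univ ≤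
      SAW.weight (rectDomain a b) 1 p₁ p₂ Set.univ * SAW.weight (rectDomain a b) 1 p₃ p₄ Set.univ := by
  simp only [weight_univ_eq_pathKernel]
  exact graphTP2_box_of_fullCheck hct hall (xc_mem_interval hμ).1 (xc_mem_interval hμ).2 p₁ p₂ p₃ p₄
    (interlaced_of_domainSAW hI) (disjointPaths_of_domainSAW hD₁) (disjointPaths_of_domainSAW hD₂)

end Sound

end Summit.CriticalPhenomena.SAWScalingLimit.Theorems.BoundaryTP2.Negative.Cert
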